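import Literature.AlgebraicTopology.KTheory.WedgeCollapse
import HarnessLib

/-!
# Injectivity of `q^* : K̃(X/A) → K⁰(X)` under *stable* extension of clutching data

`WedgeCollapse.lean` proves that `q^*` is injective on `K̃(X/A)` as soon as every inverse pair of
matrices of functions on `A` extends to an inverse pair over `X`. For the mapping cone of a map
between spheres this hypothesis only holds **stably** (a map `S²ⁿ → GL_r(ℂ)` is null-homotopic
after a block sum with an identity matrix, because `K̃(S²ⁿ⁺¹) = 0`, but not in general before),
so we record the stable form of the criterion (Hatcher, *VBKT* Prop. 2.9 / (2.7); Husemöller,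
*Fibre Bundles*, Ch. 10 Prop. 2.1): it suffices that for every inverse pair `(g, g')` over
`C(A, ℂ)` some stabilisation `1_s ⊕ g` extends invertibly over `X`
(`eq_zero_of_quotK_eq_zero_of_stable`). The proof is that of `WedgeCollapse` run with the
stabilised frames `1 ⊕ x`, `1 ⊕ y` (`algEquivalent_one_of_quot_stable`). Everything is proved.

## References

* A. Hatcher, *Vector Bundles and K-Theory* (v2.2, 2017), §2.1 Prop. 2.9, (2.7). [HatcherVBKT2017]
* D. Husemöller, *Fibre Bundles*, 3rd ed. (1994), Ch. 10 Prop. 2.1. [HusemollerFibreBundles1994]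
-/

noncomputable section

namespace Literature.AlgebraicTopology.KTheory

open Literature.RingTheory.KTheory Matrix Set TopologicalSpace

universe u

variable {X : Type u} [TopologicalSpace X] {A : Closeds X}

/-- **Stable descent of a trivialisation.** As `algEquivalent_one_of_quot`, but the transition
matrix `g = y|_A x₀` is only required to extend over `X` after a block sum `1_s ⊕ g`; the
conclusion is that `1_s ⊕ p ∼ 1` over `C(X/A, ℂ)`. [cite: HatcherVBKT2017, §2.1 Prop. 2.9] -/
theorem algEquivalent_one_of_quot_stable {n r : Type*} [Fintype n] [DecidableEq n] [Fintype r] [DecidableEq r]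
    (hext : ∀ g g' : Matrix r r C((A : Set X), ℂ), g * g' = 1 → g' * g = 1 →
      ∃ (s : ℕ) (G G' : Matrix (Fin s ⊕ r) (Fin s ⊕ r) C(X, ℂ)), G * G' = 1 ∧ G' * G = 1 ∧
        G.map (resHom (A : Set X)) = Matrix.fromBlocks 1 0 0 g)
    {p : Matrix n n C(Collapse X A, ℂ)}
    (hP : AlgEquivalent (p.map (comapRingHom (Collapse.mk A))) (1 : Matrix r r C(X, ℂ)))
    (hE : AlgEquivalent (p.map (evalRingHom (Collapse.pt A))) (1 : Matrix r r ℂ)) :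
    ∃ s : ℕ, AlgEquivalent (Matrix.fromBlocks (1 : Matrix (Fin s) (Fin s) C(Collapse X A, ℂ)) 0 0 p)
      (1 : Matrix (Fin s ⊕ r) (Fin s ⊕ r) C(Collapse X A, ℂ)) := by
  set ρ : C(X, ℂ) →+* C((A : Set X), ℂ) := resHom (A : Set X)
  set κ : ℂ →+* C((A : Set X), ℂ) := constRingHom (A : Set X)
  set q : C(Collapse X A, ℂ) →+* C(X, ℂ) := comapRingHom (Collapse.mk A)
  set ev : C(Collapse X A, ℂ) →+* ℂ := evalRingHom (Collapse.pt A)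
  set P := p.map q
  set E := p.map ev
  have hPE : P.map ρ = E.map κ := map_mk_map_resHom A p
  have hp : IsIdempotentElem p :=
    matrix_eq_of_map_mk_eq (by rw [Matrix.map_mul]; exact hP.isIdempotentElem_left.eq)
      (by rw [Matrix.map_mul]; exact hE.isIdempotentElem_left.eq)
  obtain ⟨x, y, hxy, hyx, -, -, -, hyP⟩ := hP.exists_normalized
  obtain ⟨x₀, y₀, hxy₀, hyx₀, -, -, -, hy₀E⟩ := hE.exists_normalized
  -- the transition matrix over `A` and its inverse
  set g : Matrix r r C((A : Set X), ℂ) := y.map ρ * x₀.map κ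
  set g' : Matrix r r C((A : Set X), ℂ) := y₀.map κ * x.map ρ
  have hgg' : g * g' = 1 := by
    calc g * g' = y.map ρ * (x₀.map κ * y₀.map κ) * x.map ρ := by simp only [g, g', Matrix.mul_assoc]
      _ = y.map ρ * P.map ρ * x.map ρ := by rw [← Matrix.map_mul, hxy₀, hPE]
      _ = (y * P * x).map ρ := by rw [Matrix.map_mul, Matrix.map_mul]
      _ = 1 := by rw [hyP, hyx, Matrix.map_one _ (map_zero ρ) (map_one ρ)]
  have hg'g : g' * g = 1 := by
    calc g' * g = y₀.map κ * (x.map ρ * y.map ρ) * x₀.map κ := by simp only [g, g', Matrix.mul_assoc]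
      _ = y₀.map κ * E.map κ * x₀.map κ := by rw [← Matrix.map_mul, hxy, hPE]
      _ = (y₀ * E * x₀).map κ := by rw [Matrix.map_mul, Matrix.map_mul]
      _ = 1 := by rw [hy₀E, hyx₀, Matrix.map_one _ (map_zero κ) (map_one κ)]
  obtain ⟨s, G, G', hGG', hG'G, hGρ⟩ := hext g g' hgg' hg'g
  refine ⟨s, ?_⟩
  -- the stabilised data
  set pt : Matrix (Fin s ⊕ n) (Fin s ⊕ n) C(Collapse X A, ℂ) := Matrix.fromBlocks 1 0 0 p with hpt
  set Pt : Matrix (Fin s ⊕ n) (Fin s ⊕ n) C(X, ℂ) := Matrix.fromBlocks 1 0 0 P with hPt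
  set Et : Matrix (Fin s ⊕ n) (Fin s ⊕ n) ℂ := Matrix.fromBlocks 1 0 0 E with hEt
  set xt : Matrix (Fin s ⊕ n) (Fin s ⊕ r) C(X, ℂ) := Matrix.fromBlocks 1 0 0 x with hxt
  set yt : Matrix (Fin s ⊕ r) (Fin s ⊕ n) C(X, ℂ) := Matrix.fromBlocks 1 0 0 y with hyt
  set xt₀ : Matrix (Fin s ⊕ n) (Fin s ⊕ r) ℂ := Matrix.fromBlocks 1 0 0 x₀ with hxt₀
  set yt₀ : Matrix (Fin s ⊕ r) (Fin s ⊕ n) ℂ := Matrix.fromBlocks 1 0 0 y₀ with hyt₀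
  have hpq : pt.map q = Pt := by
    rw [hpt, hPt, Matrix.fromBlocks_map, Matrix.map_one _ (map_zero q) (map_one q), Matrix.map_zero _ (map_zero q),
      Matrix.map_zero _ (map_zero q)]
  have hpev : pt.map ev = Et := by
    rw [hpt, hEt, Matrix.fromBlocks_map, Matrix.map_one _ (map_zero ev) (map_one ev), Matrix.map_zero _ (map_zero ev),
      Matrix.map_zero _ (map_zero ev)]
  have hptI : IsIdempotentElem pt := isIdempotentElem_fromBlocks IsIdempotentElem.one hp
  have hxyt : xt * yt = Pt := by
    rw [hxt, hyt, hPt, Matrix.fromBlocks_multiply]; simp [hxy]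
  have hyxt : yt * xt = 1 := by
    rw [hxt, hyt, Matrix.fromBlocks_multiply, ← Matrix.fromBlocks_one]; simp [hyx]
  have hxyt₀ : xt₀ * yt₀ = Et := by
    rw [hxt₀, hyt₀, hEt, Matrix.fromBlocks_multiply]; simp [hxy₀]
  have hyxt₀ : yt₀ * xt₀ = 1 := by
    rw [hxt₀, hyt₀, Matrix.fromBlocks_multiply, ← Matrix.fromBlocks_one]; simp [hyx₀]
  have hyPt : yt * Pt = yt := by
    rw [hyt, hPt, Matrix.fromBlocks_multiply]; simp [hyP]
  have hy₀Et : yt₀ * Et = yt₀ := by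
    rw [hyt₀, hEt, Matrix.fromBlocks_multiply]; simp [hy₀E]
  have hPEt : Pt.map ρ = Et.map κ := by
    rw [hPt, hEt, Matrix.fromBlocks_map, Matrix.fromBlocks_map, hPE, Matrix.map_one _ (map_zero ρ) (map_one ρ),
      Matrix.map_zero _ (map_zero ρ), Matrix.map_zero _ (map_zero ρ), Matrix.map_one _ (map_zero κ) (map_one κ),
      Matrix.map_zero _ (map_zero κ), Matrix.map_zero _ (map_zero κ)]
  -- the stabilised transition is `1 ⊕ g = G|_A`
  have hgt : yt.map ρ * xt₀.map κ = Matrix.fromBlocks 1 0 0 g := by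
    rw [hyt, hxt₀, Matrix.fromBlocks_map, Matrix.fromBlocks_map, Matrix.fromBlocks_multiply]
    simp [Matrix.map_one _ (map_zero ρ) (map_one ρ), Matrix.map_zero _ (map_zero ρ), Matrix.map_one _ (map_zero κ) (map_one κ),
      Matrix.map_zero _ (map_zero κ), g]
  have hg't : yt₀.map κ * xt.map ρ = Matrix.fromBlocks 1 0 0 g' := by
    rw [hyt₀, hxt, Matrix.fromBlocks_map, Matrix.fromBlocks_map, Matrix.fromBlocks_multiply]
    simp [Matrix.map_one _ (map_zero ρ) (map_one ρ), Matrix.map_zero _ (map_zero ρ), Matrix.map_one _ (map_zero κ) (map_one κ),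
      Matrix.map_zero _ (map_zero κ), g']
  have hgtg't : Matrix.fromBlocks 1 0 0 g * Matrix.fromBlocks (1 : Matrix (Fin s) (Fin s) C((A : Set X), ℂ)) 0 0 g' = 1 := by
    rw [Matrix.fromBlocks_multiply, ← Matrix.fromBlocks_one]; simp [hgg']
  have hG'ρ : G'.map ρ = Matrix.fromBlocks 1 0 0 g' := by
    have h1 : G'.map ρ * Matrix.fromBlocks 1 0 0 g = 1 := by
      rw [← hGρ, ← Matrix.map_mul, hG'G, Matrix.map_one _ (map_zero ρ) (map_one ρ)]
    calc G'.map ρ = G'.map ρ * (Matrix.fromBlocks 1 0 0 g * Matrix.fromBlocks 1 0 0 g') := by rw [hgtg't, Matrix.mul_one]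
      _ = Matrix.fromBlocks 1 0 0 g' := by rw [← Matrix.mul_assoc, h1, Matrix.one_mul]
  -- the corrected frames
  set x' := xt * G
  set y' := G' * yt
  have hx'y' : x' * y' = Pt := by
    calc x' * y' = xt * (G * G') * yt := by simp only [x', y', Matrix.mul_assoc]
      _ = Pt := by rw [hGG', Matrix.mul_one, hxyt]
  have hy'x' : y' * x' = 1 := by
    calc y' * x' = G' * (yt * xt) * G := by simp only [x', y', Matrix.mul_assoc]
      _ = 1 := by rw [hyxt, Matrix.mul_one, hG'G]
  have hx'ρ : x'.map ρ = xt₀.map κ := by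
    calc x'.map ρ = xt.map ρ * (yt.map ρ * xt₀.map κ) := by
          rw [show x' = xt * G from rfl, Matrix.map_mul, hGρ, ← hgt]
      _ = Pt.map ρ * xt₀.map κ := by rw [← Matrix.mul_assoc, ← Matrix.map_mul, hxyt]
      _ = (Et * xt₀).map κ := by rw [hPEt, Matrix.map_mul]
      _ = xt₀.map κ := by rw [← hxyt₀, Matrix.mul_assoc, hyxt₀, Matrix.mul_one]
  have hy'ρ : y'.map ρ = yt₀.map κ := by
    calc y'.map ρ = yt₀.map κ * (xt.map ρ * yt.map ρ) := by
          rw [show y' = G' * yt from rfl, Matrix.map_mul, hG'ρ, ← hg't, Matrix.mul_assoc]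
      _ = yt₀.map κ * Pt.map ρ := by rw [← Matrix.map_mul, hxyt]
      _ = (yt₀ * Et).map κ := by rw [hPEt, Matrix.map_mul]
      _ = yt₀.map κ := by rw [hy₀Et]
  -- descend the frames to `X/A`
  have hcx := apply_eq_of_map_resHom_eq hx'ρ
  have hcy := apply_eq_of_map_resHom_eq hy'ρ
  refine AlgEquivalent.of_mul_eq hptI IsIdempotentElem.one (x := descendMatrix x' xt₀ hcx)
    (y := descendMatrix y' yt₀ hcy) ?_ ?_
  · exact matrix_eq_of_map_mk_eq
      (by rw [Matrix.map_mul, descendMatrix_map_mk, descendMatrix_map_mk, hx'y', ← hpq])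
      (by rw [Matrix.map_mul, descendMatrix_map_eval_pt, descendMatrix_map_eval_pt, hxyt₀, ← hpev])
  · exact matrix_eq_of_map_mk_eq
      (by rw [Matrix.map_mul, descendMatrix_map_mk, descendMatrix_map_mk, hy'x',
        Matrix.map_one _ (map_zero _) (map_one _)])
      (by rw [Matrix.map_mul, descendMatrix_map_eval_pt, descendMatrix_map_eval_pt, hyxt₀,
        Matrix.map_one _ (map_zero _) (map_one _)])

/-- **Injectivity of `q^* : K̃(X/A) → K⁰(X)` under stable extension**: if for every inverse pair
`(g, g')` of square matrices over `C(A, ℂ)` some block sum `1_s ⊕ g` extends to an inverse pair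
over `C(X, ℂ)`, then a reduced class on `X/A` which pulls back to `0` on `X` vanishes.
[cite: HatcherVBKT2017, §2.1 Prop. 2.9] -/
theorem eq_zero_of_quotK_eq_zero_of_stable
    (hext : ∀ (r : ℕ) (g g' : Matrix (Fin r) (Fin r) C((A : Set X), ℂ)), g * g' = 1 → g' * g = 1 →
      ∃ (s : ℕ) (G G' : Matrix (Fin s ⊕ Fin r) (Fin s ⊕ Fin r) C(X, ℂ)), G * G' = 1 ∧ G' * G = 1 ∧
        G.map (resHom (A : Set X)) = Matrix.fromBlocks 1 0 0 g)
    {b : K0 (Collapse X A)} (hb : b ∈ Reduced (Collapse X A) (Collapse.pt A)) (h0 : quotK A b = 0) :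
    b = 0 := by
  obtain ⟨p, p₀, rfl⟩ := KZero.exists_of_sub_of b
  -- rewrite `b = [p ⊕ (1 - p₀)] - [1_N]`
  set N := p₀.size
  set p₁ : Idem C(Collapse X A, ℂ) := p + p₀.compl
  have hb' : KZero.of p - KZero.of p₀ = KZero.of p₁ - KZero.of (Idem.unit N : Idem C(Collapse X A, ℂ)) := by
    rw [KZero.of_add, ← KZero.of_add_of_compl p₀]; abel
  rw [hb'] at hb h0 ⊢
  -- `q^* p₁` is stably trivial of rank `N`
  have hq : KZero.of (p₁.map (comapRingHom (Collapse.mk A))) = KZero.of (Idem.unit N) := by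
    rw [map_sub, sub_eq_zero, pullback_of, pullback_of, Idem.map_unit] at h0
    exact h0
  obtain ⟨m, hm⟩ := KZero.of_eq_of_iff_exists_unit.1 hq
  rw [Idem.unit_add_unit] at hm
  set p₂ : Idem C(Collapse X A, ℂ) := Idem.unit m + p₁
  have hP : AlgEquivalent (p₂.mat.map (comapRingHom (Collapse.mk A)))
      (1 : Matrix (Fin (m + N)) (Fin (m + N)) C(X, ℂ)) := by
    have h1 : p₂.map (comapRingHom (Collapse.mk A)) = Idem.unit m + p₁.map (comapRingHom (Collapse.mk A)) := by
      rw [Idem.map_add, Idem.map_unit]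
    have h2 := Idem.equiv_iff.1 hm
    rw [← h1] at h2
    exact h2
  -- the rank of `p₂` at the base point is `m + N`
  have hrank : (p₁.map (evalRingHom (Collapse.pt A))).rank = N := by
    have h := mem_reduced_iff.1 hb
    rw [map_sub, rankAt_of, rankAt_of_unit, sub_eq_zero, Nat.cast_inj] at h
    exact h
  have hE : AlgEquivalent (p₂.mat.map (evalRingHom (Collapse.pt A))) (1 : Matrix (Fin (m + N)) (Fin (m + N)) ℂ) := by
    have h1 : p₂.map (evalRingHom (Collapse.pt A)) = Idem.unit m + p₁.map (evalRingHom (Collapse.pt A)) := by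
      rw [Idem.map_add, Idem.map_unit]
    have h2 : (p₂.map (evalRingHom (Collapse.pt A))).rank = m + N := by
      rw [h1, Idem.rank_add, Idem.rank_unit, hrank]
    exact Idem.equiv_iff.1 (Idem.rank_eq_iff.1 h2)
  obtain ⟨s, key⟩ := algEquivalent_one_of_quot_stable (hext (m + N)) hP hE
  -- `[1_s ⊕ p₂] = [1_{s + (m + N)}]`, so `[p₂] = [1_{m+N}]`
  have hof : KZero.of (Idem.unit s + p₂) = KZero.of (Idem.unit (s + (m + N)) : Idem C(Collapse X A, ℂ)) := by
    apply KZero.of_eq_of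
    refine (Idem.add_equiv_fromBlocks _ _).trans (key.trans ?_)
    have h1 : AlgEquivalent (1 : Matrix (Fin s ⊕ Fin (m + N)) (Fin s ⊕ Fin (m + N)) C(Collapse X A, ℂ))
        (Matrix.reindex finSumFinEquiv finSumFinEquiv (1 : Matrix (Fin s ⊕ Fin (m + N)) (Fin s ⊕ Fin (m + N)) C(Collapse X A, ℂ))) :=
      AlgEquivalent.reindex IsIdempotentElem.one _
    rw [Matrix.reindex_apply, Matrix.submatrix_one_equiv] at h1
    exact h1
  have hof' : KZero.of p₂ = KZero.of (Idem.unit (m + N) : Idem C(Collapse X A, ℂ)) := by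
    have h1 : KZero.of (Idem.unit s + p₂) = KZero.of (Idem.unit s : Idem C(Collapse X A, ℂ)) + KZero.of p₂ := KZero.of_add _ _
    have h2 : KZero.of (Idem.unit (s + (m + N)) : Idem C(Collapse X A, ℂ)) =
        KZero.of (Idem.unit s : Idem C(Collapse X A, ℂ)) + KZero.of (Idem.unit (m + N) : Idem C(Collapse X A, ℂ)) := by
      rw [← KZero.of_add, Idem.unit_add_unit]
    rw [h1, h2] at hof
    exact add_left_cancel hof
  have hp₁ : KZero.of p₁ = KZero.of p₂ - KZero.of (Idem.unit m : Idem C(Collapse X A, ℂ)) := by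
    have h : KZero.of p₂ = KZero.of (Idem.unit m : Idem C(Collapse X A, ℂ)) + KZero.of p₁ := KZero.of_add _ _
    rw [h]; abel
  rw [hp₁, hof', ← Idem.unit_add_unit, KZero.of_add]
  abel

end Literature.AlgebraicTopology.KTheory

end
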